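import Mathlib.Analysis.SpecialFunctions.Integrals.Basic
import Mathlib.Analysis.SpecialFunctions.Pow.Asymptotics
import Literature.NumberTheory.LFunctions.MontgomeryTheoremGoldstonMontgomery
import Literature.NumberTheory.LFunctions.AlternativeHypothesisFormFactor
import HarnessLib

/-!
# Montgomery's theorem against test functions on `[−1, 1]`: the RH-only case of BGSTB 2025, Theorem 3

Topic `Literature/NumberTheory/LFunctions` (namespace `Literature.NumberTheory.LFunctions.Montgomery`).
Proofs only: no definitions, no named facts. LABEL: RH is the printed ANTECEDENT (as in Montgomery 1973);
nothing here bears on the truth of RH. Companion of `MontgomeryTheoremWindowIntegrals.lean` (unweighted windows).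

Baluyot–Goldston–Suriajaya–Turnage-Butterbaugh 2025, Theorem 3: "Let `g` be a Riemann integrable function on
a closed interval `[a, b]` … Lipschitz continuous at `ℤ ∖ {−1, 1}` … Assuming the Riemann Hypothesis and
AH-Pairs, we have as `T → ∞` that `∫_a^b F(α) g(α) dα = ∫_a^b 𝓕(α) g(α) dα + o(1)`", with
`𝓕(α) = |α| + δ_0(α)` on `[−1, 1]` ((calF): `s(α) = |α|` for `|α| ≤ 1`, the unit mass at `0` split as
`δ_0^=`, half on each side). Its proof (§7) uses AH-Pairs only through Lemma 6 at the windows around the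
integers `N ≠ 0` and outside `(−1, 1)`; on `[−1, 1]` it uses (MT) alone ("assuming only RH we apply MT and
have `∫_0^λ F(β) dβ = ½ + O(λ) + o(1)` … Next consider a function `g(α)` which is Lipschitz continuous at
`α = N ∈ ℤ`. Then `∫_{N−λ}^{N+λ} F(α) g(α) dα ∼ g(N) ∫_{N−λ}^{N+λ} 𝓕(α) dα`, and the corresponding one-sided
results hold when `N = 0, ±1`. … Thus by approximation this also holds for any Riemann integrable function
`g(α)`").
Here the `[a, b] ⊆ [−1, 1]` case is proved from RH ALONE, directly from the tree's Montgomery theorem with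
the Goldston–Montgomery error term (`Montgomery.montgomery_pair_correlation_sqrtLog`,
`MontgomeryTheoremGoldstonMontgomery.lean`) and the kernel `T^{−2|α|} log T`, without the step-function detour:

* `Montgomery.tendsto_integral_rpow_mul_log_mul` — the one-sided mass at `0`: for `h` integrable and bounded
  on `[0, c]` and right-Lipschitz at `0`, `∫_0^c T^{−2α} log T · h(α) dα → h(0)/2`
  (`Montgomery.tendsto_integral_rpow_abs_mul_log_mul`: the two-sided version, `→ h(0)`);
* `Montgomery.tendsto_integral_formFactor_mul_of_subset_Icc` (and the primed form with "Riemann integrable"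
  rendered as in the typed `bgstb2025_theorem3`: bounded and a.e. continuous within `[a, b]`) — assuming RH,
  for `−1 ≤ a ≤ b ≤ 1` and `g` Lipschitz at `0`,
  `∫_a^b F(α,T) g(α) dα − (∫_a^b |α| g(α) dα + g(0)(½[a<0≤b] + ½[a≤0<b])) → 0`; the subtracted quantity is
  `AH.calFIntegral P₀ a b g` of `AlternativeHypothesisFormFactor.lean` for every `P₀` (no other mass of `𝓕`
  meets `[a, b] ⊆ [−1, 1]`), so this is the `[a,b] ⊆ [−1,1]` case of `bgstb2025_theorem3` with AH-Pairs and
  the Lipschitz conditions at `±1, ±2, …` not needed;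
* `AH.calFIntegral_eq_of_subset_Icc`, `bgstb2025_theorem3_of_subset_Icc` — the same in the vocabulary and the
  exact binder shape of the typed claim `bgstb2025_theorem3` (`AlternativeHypothesisFormFactor.lean`): on
  `[a, b] ⊆ [−1, 1]`, `AH.calFIntegral P₀ a b g = ∫_a^b |α| g + g(0)(½[a<0≤b] + ½[a≤0<b])` for every `P₀`, and
  the conclusion of Theorem 3 holds there assuming RH only (for every `δ`, `M`).

## References

* [BaluyotGoldstonSuriajayaTurnageButterbaugh2025] arXiv:2508.10857, §2 (MT), (calF), Theorem 3; §7 (proof of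
  Theorem 3). [claim: BaluyotGoldstonSuriajayaTurnageButterbaugh2025, status: under-review]
* [GoldstonMontgomery1987] D. A. Goldston, H. L. Montgomery, Progr. Math. 70 (1987), §3 Lemma 8 (the input (MT)).
* [Montgomery1973] H. L. Montgomery, *The pair correlation of zeros of the zeta function*, Theorem.
-/

noncomputable section

open Filter Set MeasureTheory Real Asymptotics
open scoped Topology

namespace Literature.NumberTheory.LFunctions

namespace Montgomery

/-- `∫_a^b e^{−c x} dx = (e^{−c a} − e^{−c b})/c` (`c ≠ 0`). [folklore] -/
private theorem integral_exp_neg_mul_eq' {c : ℝ} (hc : c ≠ 0) (a b : ℝ) :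
    ∫ x in a..b, Real.exp (-c * x) = (Real.exp (-c * a) - Real.exp (-c * b)) / c := by
  rw [intervalIntegral.integral_comp_mul_left (fun x ↦ Real.exp x) (neg_ne_zero.2 hc), integral_exp]
  simp only [smul_eq_mul]
  field_simp
  ring

/-- `F(·, T)` is continuous (a finite cosine sum). [folklore] -/
private theorem continuous_formFactor_left' (T : ℝ) :
    Continuous fun a : ℝ ↦ montgomeryFormFactor a T := by
  unfold montgomeryFormFactor
  fun_prop

/-- `L a e^{−2La} ≤ e^{−La}` (from `La ≤ e^{La}`). [folklore] -/
private theorem mul_mul_exp_neg_two_mul_le' (L a : ℝ) :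
    L * a * Real.exp (-(2 * L) * a) ≤ Real.exp (-L * a) := by
  have h1 : L * a ≤ Real.exp (L * a) := by linarith [Real.add_one_le_exp (L * a)]
  have e : Real.exp (-L * a) = Real.exp (L * a) * Real.exp (-(2 * L) * a) := by
    rw [← Real.exp_add]; congr 1; ring
  rw [e]
  exact mul_le_mul_of_nonneg_right h1 (Real.exp_pos _).le

/-- **The mass at `0`, one-sided** (the computation behind BGSTB 2025, §7: "Next consider a function `g(α)`
which is Lipschitz continuous at `α = N ∈ ℤ`. Then `∫_{N−λ}^{N+λ} F(α) g(α) dα ∼ g(N) ∫_{N−λ}^{N+λ} 𝓕(α) dα`,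
and the corresponding one-sided results hold when `N = 0, ±1`", here with the kernel `T^{−2α} log T` of (MT)
at `N = 0`): for
`0 < c`, `h` integrable and bounded on `[0, c]` and right-Lipschitz at `0`,
`∫_0^c T^{−2α} log T · h(α) dα → h(0)/2` as `T → ∞`.
[cite: BaluyotGoldstonSuriajayaTurnageButterbaugh2025, §7 (proof of Theorem 3)] -/
theorem tendsto_integral_rpow_mul_log_mul {c : ℝ} (hc0 : 0 < c) {h : ℝ → ℝ}
    (hhi : IntervalIntegrable h volume 0 c) {B : ℝ} (hB : ∀ α ∈ Set.Icc 0 c, |h α| ≤ B)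
    {Cg δ : ℝ} (hδ : 0 < δ) (hLip : ∀ α : ℝ, 0 ≤ α → α < δ → |h α - h 0| ≤ Cg * α) :
    Tendsto (fun T : ℝ ↦ ∫ α in (0 : ℝ)..c, T ^ (-2 * α) * Real.log T * h α) atTop
      (𝓝 (h 0 / 2)) := by
  rw [tendsto_iff_norm_sub_tendsto_zero]
  -- constants
  set Cg' : ℝ := max Cg 0 with hCg'
  have hCg'0 : 0 ≤ Cg' := le_max_right _ _
  have hCgle : Cg ≤ Cg' := le_max_left _ _
  set δ₁ : ℝ := min δ c / 2 with hδ₁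
  have hmin0 : 0 < min δ c := lt_min hδ hc0
  have hδ₁0 : 0 < δ₁ := by rw [hδ₁]; positivity
  have hδ₁δ : δ₁ < δ := by have := min_le_left δ c; rw [hδ₁]; linarith
  have hδ₁c : δ₁ < c := by have := min_le_right δ c; rw [hδ₁]; linarith
  have hB0 : 0 ≤ B := (abs_nonneg _).trans (hB 0 ⟨le_rfl, hc0.le⟩)
  -- the majorant tends to `0`
  have hlim : Tendsto (fun T : ℝ ↦ Cg' * (Real.log T)⁻¹ +
      (B + |h 0|) * c * (Real.log T / T ^ (2 * δ₁)) + |h 0| / 2 * T ^ (-(2 * c))) atTop (𝓝 0) := by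
    have h1 := Real.tendsto_log_atTop.inv_tendsto_atTop
    have h2 := (isLittleO_log_rpow_atTop (by positivity : 0 < 2 * δ₁)).tendsto_div_nhds_zero
    have h3 := tendsto_rpow_neg_atTop (by positivity : 0 < 2 * c)
    have := ((h1.const_mul Cg').add (h2.const_mul ((B + |h 0|) * c))).add (h3.const_mul (|h 0| / 2))
    simpa using this
  refine squeeze_zero' (Eventually.of_forall fun T ↦ norm_nonneg _) ?_ hlim
  filter_upwards [eventually_ge_atTop 3] with T hT3
  have hT0 : 0 < T := by linarith
  have hT1 : (1 : ℝ) < T := by linarith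
  set L : ℝ := Real.log T with hL
  have hL0 : 0 < L := Real.log_pos hT1
  set E : ℝ → ℝ := fun α ↦ Real.exp (-(2 * L) * α) with hEdef
  have hE : ∀ α : ℝ, T ^ (-2 * α) = E α := fun α ↦ by
    rw [hEdef, Real.rpow_def_of_pos hT0]; congr 1; ring
  have hE0 : ∀ α, 0 < E α := fun α ↦ Real.exp_pos _
  have hEmono : ∀ α β : ℝ, α ≤ β → E β ≤ E α := fun α β h ↦ Real.exp_le_exp.2 (by nlinarith)
  have hEc : Continuous E := by rw [hEdef]; fun_prop
  have hEδ : E δ₁ = 1 / T ^ (2 * δ₁) := by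
    rw [← hE, show -2 * δ₁ = -(2 * δ₁) by ring, Real.rpow_neg hT0.le, one_div]
  have hEc2 : E c = T ^ (-(2 * c)) := by rw [← hE]; ring_nf
  -- rewrite the integrand
  have hcongr : ∫ α in (0 : ℝ)..c, T ^ (-2 * α) * Real.log T * h α = ∫ α in (0 : ℝ)..c, L * E α * h α := by
    refine intervalIntegral.integral_congr fun α _ ↦ ?_
    simp only [hE α]; ring
  rw [hcongr]
  -- integrability
  have hi1 : IntervalIntegrable (fun α ↦ L * E α * h α) volume 0 c :=
    hhi.continuousOn_mul (continuous_const.mul hEc).continuousOn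
  have hi2 : IntervalIntegrable (fun α ↦ L * E α * h 0) volume 0 c :=
    ((continuous_const.mul hEc).mul continuous_const).intervalIntegrable _ _
  have hIE : L * ∫ α in (0 : ℝ)..c, E α = (1 - E c) / 2 := by
    rw [hEdef, integral_exp_neg_mul_eq' (by positivity : (2 * L) ≠ 0) 0 c]
    simp only [mul_zero, Real.exp_zero]
    field_simp
  have hsplit : (∫ α in (0 : ℝ)..c, L * E α * h α) - h 0 / 2 =
      (∫ α in (0 : ℝ)..c, L * E α * (h α - h 0)) - h 0 * E c / 2 := by
    have e1 : ∫ α in (0 : ℝ)..c, L * E α * (h α - h 0) =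
        (∫ α in (0 : ℝ)..c, L * E α * h α) - ∫ α in (0 : ℝ)..c, L * E α * h 0 := by
      rw [← intervalIntegral.integral_sub hi1 hi2]
      refine intervalIntegral.integral_congr fun α _ ↦ ?_
      ring
    have e2 : ∫ α in (0 : ℝ)..c, L * E α * h 0 = h 0 * (L * ∫ α in (0 : ℝ)..c, E α) := by
      rw [← intervalIntegral.integral_const_mul, ← intervalIntegral.integral_const_mul]
      refine intervalIntegral.integral_congr fun α _ ↦ ?_
      ring
    rw [e1, e2, hIE]
    ring
  rw [hsplit]
  -- the pointwise majorant on `(0, c]`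
  set b : ℝ → ℝ := fun α ↦ Cg' * Real.exp (-L * α) + (B + |h 0|) * (L * E δ₁) with hb
  have hpt : ∀ α ∈ Set.Ioc (0 : ℝ) c, ‖L * E α * (h α - h 0)‖ ≤ b α := by
    intro α hα
    obtain ⟨hα0, hαc⟩ := hα
    rw [Real.norm_eq_abs, abs_mul, abs_of_pos (mul_pos hL0 (hE0 α))]
    have hb' : b α = Cg' * Real.exp (-L * α) + (B + |h 0|) * (L * E δ₁) := rfl
    rw [hb']
    have hn1 : 0 ≤ Cg' * Real.exp (-L * α) := by positivity
    have hn2 : 0 ≤ (B + |h 0|) * (L * E δ₁) := by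
      have := hE0 δ₁; positivity
    rcases lt_or_ge α δ₁ with had | had
    · have h1 : |h α - h 0| ≤ Cg' * α :=
        (hLip α hα0.le (had.trans hδ₁δ)).trans (mul_le_mul_of_nonneg_right hCgle hα0.le)
      have t : L * E α * |h α - h 0| ≤ Cg' * Real.exp (-L * α) := by
        calc L * E α * |h α - h 0| ≤ L * E α * (Cg' * α) :=
              mul_le_mul_of_nonneg_left h1 (mul_pos hL0 (hE0 α)).le
          _ = Cg' * (L * α * Real.exp (-(2 * L) * α)) := by rw [hEdef]; ring
          _ ≤ Cg' * Real.exp (-L * α) :=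
              mul_le_mul_of_nonneg_left (mul_mul_exp_neg_two_mul_le' L α) hCg'0
      linarith
    · have h1 : |h α - h 0| ≤ B + |h 0| :=
        (abs_sub _ _).trans (add_le_add (hB α ⟨hα0.le, hαc⟩) le_rfl)
      have h2 : L * E α ≤ L * E δ₁ := mul_le_mul_of_nonneg_left (hEmono _ _ had) hL0.le
      have t : L * E α * |h α - h 0| ≤ (B + |h 0|) * (L * E δ₁) := by
        calc L * E α * |h α - h 0| ≤ L * E α * (B + |h 0|) :=
              mul_le_mul_of_nonneg_left h1 (mul_pos hL0 (hE0 α)).le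
          _ ≤ L * E δ₁ * (B + |h 0|) := mul_le_mul_of_nonneg_right h2 (by positivity)
          _ = (B + |h 0|) * (L * E δ₁) := by ring
      linarith
  have hb1i : IntervalIntegrable (fun α ↦ Cg' * Real.exp (-L * α)) volume 0 c :=
    ((by fun_prop : Continuous fun α ↦ Real.exp (-L * α)).intervalIntegrable _ _).const_mul _
  have hb2i : IntervalIntegrable (fun _ : ℝ ↦ (B + |h 0|) * (L * E δ₁)) volume 0 c :=
    intervalIntegrable_const
  have hbi : IntervalIntegrable b volume 0 c := by rw [hb]; exact hb1i.add hb2i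
  have hIb : ∫ α in (0 : ℝ)..c, b α ≤ Cg' * L⁻¹ + (B + |h 0|) * c * (L / T ^ (2 * δ₁)) := by
    rw [hb, intervalIntegral.integral_add hb1i hb2i, intervalIntegral.integral_const_mul,
      intervalIntegral.integral_const, smul_eq_mul, integral_exp_neg_mul_eq' hL0.ne' 0 c]
    have h1 : (Real.exp (-L * 0) - Real.exp (-L * c)) / L ≤ L⁻¹ := by
      rw [mul_zero, Real.exp_zero, inv_eq_one_div]
      exact div_le_div_of_nonneg_right (by linarith [Real.exp_pos (-L * c)]) hL0.le
    have h2 : (c - 0) * ((B + |h 0|) * (L * E δ₁)) = (B + |h 0|) * c * (L / T ^ (2 * δ₁)) := by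
      rw [hEδ]; ring
    rw [h2]
    have := mul_le_mul_of_nonneg_left h1 hCg'0
    linarith
  have hnorm := intervalIntegral.norm_integral_le_of_norm_le hc0.le (Eventually.of_forall hpt) hbi
  -- conclude
  calc ‖(∫ α in (0 : ℝ)..c, L * E α * (h α - h 0)) - h 0 * E c / 2‖
      ≤ ‖∫ α in (0 : ℝ)..c, L * E α * (h α - h 0)‖ + ‖h 0 * E c / 2‖ := norm_sub_le _ _
    _ ≤ (Cg' * L⁻¹ + (B + |h 0|) * c * (L / T ^ (2 * δ₁))) + |h 0| / 2 * T ^ (-(2 * c)) := by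
        refine add_le_add (hnorm.trans hIb) (le_of_eq ?_)
        rw [Real.norm_eq_abs, hEc2, abs_div, abs_mul, abs_of_pos (Real.rpow_pos_of_pos hT0 _),
          abs_two]
        ring


/-- **The mass at `0`, two-sided**: for `0 < c`, `h` integrable and bounded on `[−c, c]` and Lipschitz at `0`,
`∫_{−c}^{c} T^{−2|α|} log T · h(α) dα → h(0)` (both one-sided halves, BGSTB's `δ_0^=`).
[cite: BaluyotGoldstonSuriajayaTurnageButterbaugh2025, §7 (proof of Theorem 3)] -/
theorem tendsto_integral_rpow_abs_mul_log_mul {c : ℝ} (hc0 : 0 < c) {h : ℝ → ℝ}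
    (hhi : IntervalIntegrable h volume (-c) c) {B : ℝ} (hB : ∀ α ∈ Set.Icc (-c) c, |h α| ≤ B)
    {Cg δ : ℝ} (hδ : 0 < δ) (hLip : ∀ α : ℝ, |α| < δ → |h α - h 0| ≤ Cg * |α|) :
    Tendsto (fun T : ℝ ↦ ∫ α in (-c)..c, T ^ (-2 * |α|) * Real.log T * h α) atTop (𝓝 (h 0)) := by
  -- right half
  have hR : Tendsto (fun T : ℝ ↦ ∫ α in (0 : ℝ)..c, T ^ (-2 * |α|) * Real.log T * h α) atTop
      (𝓝 (h 0 / 2)) := by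
    have h1 := tendsto_integral_rpow_mul_log_mul hc0 (hhi.mono_set (by
        rw [uIcc_of_le (by linarith : -c ≤ c), uIcc_of_le hc0.le]
        exact Icc_subset_Icc (by linarith) le_rfl)) (B := B)
      (fun α hα ↦ hB α ⟨by linarith [hα.1], hα.2⟩) hδ (Cg := Cg)
      (fun α hα0 hαδ ↦ by
        have := hLip α (by rwa [abs_of_nonneg hα0]); rwa [abs_of_nonneg hα0] at this)
    refine h1.congr' (Eventually.of_forall fun T ↦ ?_)
    refine intervalIntegral.integral_congr fun α hα ↦ ?_
    rw [uIcc_of_le hc0.le] at hα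
    simp only [abs_of_nonneg hα.1]
  -- left half, by `α ↦ −α`
  have hL : Tendsto (fun T : ℝ ↦ ∫ α in (-c)..(0 : ℝ), T ^ (-2 * |α|) * Real.log T * h α) atTop
      (𝓝 (h 0 / 2)) := by
    have hhi0 : IntervalIntegrable h volume (-c) 0 := hhi.mono_set (by
      rw [uIcc_of_le (by linarith : -c ≤ c), uIcc_of_le (by linarith : -c ≤ 0)]
      exact Icc_subset_Icc le_rfl hc0.le)
    have hhi' : IntervalIntegrable (fun x ↦ h (-x)) volume 0 c := by
      have h1 := (IntervalIntegrable.iff_comp_neg).1 hhi0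
      rw [neg_neg, neg_zero] at h1
      exact h1.symm
    have h1 := tendsto_integral_rpow_mul_log_mul hc0 hhi' (B := B)
      (fun α hα ↦ hB (-α) ⟨by linarith [hα.2], by linarith [hα.1]⟩) hδ (Cg := Cg)
      (fun α hα0 hαδ ↦ by
        rw [neg_zero]
        have := hLip (-α) (by rwa [abs_neg, abs_of_nonneg hα0])
        rwa [abs_neg, abs_of_nonneg hα0] at this)
    rw [neg_zero] at h1
    refine h1.congr' (Eventually.of_forall fun T ↦ ?_)
    have hc' := intervalIntegral.integral_comp_neg (a := 0) (b := c)
      (fun α : ℝ ↦ T ^ (-2 * |α|) * Real.log T * h α)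
    rw [neg_zero] at hc'
    show _ = ∫ α in (-c)..(0 : ℝ), T ^ (-2 * |α|) * Real.log T * h α
    rw [← hc']
    refine intervalIntegral.integral_congr fun α hα ↦ ?_
    rw [uIcc_of_le hc0.le] at hα
    simp only [abs_neg, abs_of_nonneg hα.1]
  -- glue
  have hsum : ∀ᶠ T : ℝ in atTop, (∫ α in (-c)..(0 : ℝ), T ^ (-2 * |α|) * Real.log T * h α) +
      (∫ α in (0 : ℝ)..c, T ^ (-2 * |α|) * Real.log T * h α) =
        ∫ α in (-c)..c, T ^ (-2 * |α|) * Real.log T * h α := by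
    filter_upwards [eventually_gt_atTop 0] with T hT0
    have hc : Continuous fun α : ℝ ↦ T ^ (-2 * |α|) * Real.log T := by
      have e : (fun α : ℝ ↦ T ^ (-2 * |α|) * Real.log T) =
          fun α ↦ Real.exp (Real.log T * (-2 * |α|)) * Real.log T := by
        funext α; rw [Real.rpow_def_of_pos hT0]
      rw [e]; fun_prop
    have hi : ∀ u v : ℝ, IntervalIntegrable h volume u v →
        IntervalIntegrable (fun α ↦ T ^ (-2 * |α|) * Real.log T * h α) volume u v :=
      fun u v hh ↦ hh.continuousOn_mul hc.continuousOn
    exact intervalIntegral.integral_add_adjacent_intervals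
      (hi _ _ (hhi.mono_set (by
        rw [uIcc_of_le (by linarith : -c ≤ c), uIcc_of_le (by linarith : -c ≤ 0)]
        exact Icc_subset_Icc le_rfl hc0.le)))
      (hi _ _ (hhi.mono_set (by
        rw [uIcc_of_le (by linarith : -c ≤ c), uIcc_of_le hc0.le]
        exact Icc_subset_Icc (by linarith) le_rfl)))
  have h := hL.add hR
  rw [add_halves] at h
  exact h.congr' hsum


/-- `∫_a^b T^{−2|α|} log T dα ≤ 1` for `[a, b] ⊆ [−1, 1]`, `T > 1`
(`= ∫ over [a,b] ≤ ∫_{−1}^{1} = 1 − T^{−2}`). [folklore] -/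
private theorem integral_kernel_le_one {T a b : ℝ} (hT : 1 < T) (ha : -1 ≤ a) (hab : a ≤ b)
    (hb : b ≤ 1) : ∫ α in a..b, T ^ (-2 * |α|) * Real.log T ≤ 1 := by
  have hT0 : 0 < T := by linarith
  set L : ℝ := Real.log T with hL
  have hL0 : 0 < L := Real.log_pos hT
  set ψ : ℝ → ℝ := fun α ↦ Real.exp (-(2 * L) * |α|) * L with hψ
  have hE : ∀ α : ℝ, T ^ (-2 * |α|) * Real.log T = ψ α := fun α ↦ by
    simp only [hψ, Real.rpow_def_of_pos hT0]; congr 2; ring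
  have hψc : Continuous ψ := by rw [hψ]; fun_prop
  have hψi : ∀ u v : ℝ, IntervalIntegrable ψ volume u v := fun u v ↦ hψc.intervalIntegrable u v
  have hψ0 : ∀ α, 0 ≤ ψ α := fun α ↦ by positivity
  rw [intervalIntegral.integral_congr (g := ψ) fun α _ ↦ hE α]
  have h1 : ∫ α in a..b, ψ α ≤ ∫ α in (-1 : ℝ)..1, ψ α :=
    intervalIntegral.integral_mono_interval ha hab hb (Eventually.of_forall hψ0) (hψi _ _)
  have h2 : ∫ α in (-1 : ℝ)..0, ψ α = ∫ α in (0 : ℝ)..1, ψ α := by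
    have h := intervalIntegral.integral_comp_neg (a := 0) (b := 1) ψ
    rw [neg_zero] at h
    rw [← h]
    refine intervalIntegral.integral_congr fun α _ ↦ ?_
    simp only [hψ, abs_neg]
  have h3 : ∫ α in (0 : ℝ)..1, ψ α = (1 - Real.exp (-(2 * L))) / 2 := by
    have e : ∫ α in (0 : ℝ)..1, ψ α = ∫ α in (0 : ℝ)..1, Real.exp (-(2 * L) * α) * L := by
      refine intervalIntegral.integral_congr fun α hα ↦ ?_
      rw [uIcc_of_le zero_le_one] at hα
      simp only [hψ, abs_of_nonneg hα.1]
    rw [e, intervalIntegral.integral_mul_const, integral_exp_neg_mul_eq' (by positivity : (2 * L) ≠ 0) 0 1]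
    simp only [mul_zero, Real.exp_zero, mul_one]
    field_simp
  rw [← intervalIntegral.integral_add_adjacent_intervals (hψi (-1) 0) (hψi 0 1), h2, h3] at h1
  have h4 : 0 < Real.exp (-(2 * L)) := Real.exp_pos _
  linarith

/-- **BGSTB 2025, Theorem 3 on `[a, b] ⊆ [−1, 1]`, from RH ALONE** (the windows of §7 that use only (MT):
"assuming only RH we apply MT and have `∫_0^λ F(β) dβ = ½ + O(λ) + o(1)` … Next consider a function
`g(α)` which is Lipschitz continuous at `α = N ∈ ℤ`. Then
`∫_{N−λ}^{N+λ} F(α) g(α) dα ∼ g(N) ∫_{N−λ}^{N+λ} 𝓕(α) dα`, and the corresponding one-sided results hold when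
`N = 0, ±1`. … `∫_{a−λ}^{a+λ} F(α) dα ∼ ∫_{a−λ}^{a+λ} s(α) dα ∼ ∫_{a−λ}^{a+λ} 𝓕(α) dα` … Thus by
approximation this also holds for any Riemann integrable function `g(α)`"): assuming RH, for
`−1 ≤ a ≤ b ≤ 1` and `g` integrable and bounded on `[a, b]` and Lipschitz at `0` (the hypothesis is
`IsLipschitzAt g 0` of `AlternativeHypothesis.lean`, spelled out), as `T → ∞`,
`∫_a^b F(α,T) g(α) dα → ∫_a^b |α| g(α) dα + g(0)·(½[a<0≤b] + ½[a≤0<b])`, which is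
`AH.calFIntegral P₀ a b g` for every `P₀` (no mass of `𝓕` other than `δ_0` meets `[a, b] ⊆ [−1, 1]`, and
`s(α) = |α|` there). No AH-Pairs is needed on this range. Here directly from (MT) with the kernel
`T^{−2|α|} log T` (`Montgomery.tendsto_integral_rpow_mul_log_mul`), without the step-function detour.
[cite: BaluyotGoldstonSuriajayaTurnageButterbaugh2025, §7 (proof of Theorem 3)] -/
theorem tendsto_integral_formFactor_mul_of_subset_Icc (hRH : RiemannHypothesis) {a b : ℝ}
    {g : ℝ → ℝ} (hab : a ≤ b) (ha : -1 ≤ a) (hb : b ≤ 1) (hgi : IntervalIntegrable g volume a b)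
    {B : ℝ} (hB : ∀ x ∈ Set.Icc a b, |g x| ≤ B)
    (hLip : ∃ C δ : ℝ, 0 < δ ∧ ∀ x : ℝ, |x - 0| < δ → |g x - g 0| ≤ C * |x - 0|) :
    Tendsto (fun T : ℝ ↦ (∫ α in a..b, montgomeryFormFactor α T * g α) -
        ((∫ α in a..b, |α| * g α) +
          g 0 * ((if a < 0 ∧ 0 ≤ b then 1 / 2 else 0) + (if a ≤ 0 ∧ 0 < b then 1 / 2 else 0))))
      atTop (𝓝 0) := by
  obtain ⟨Cg, δ, hδ, hLip⟩ := hLip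
  simp only [sub_zero] at hLip
  obtain ⟨C₃, hC₃⟩ := montgomery_pair_correlation_sqrtLog hRH
  have hB0 : 0 ≤ B := (abs_nonneg _).trans (hB a ⟨le_rfl, hab⟩)
  -- the pieces, as functions of `T`
  set I : ℝ → ℝ := fun T ↦ ∫ α in a..b, montgomeryFormFactor α T * g α with hI
  set K : ℝ → ℝ := fun T ↦ ∫ α in a..b, T ^ (-2 * |α|) * Real.log T * g α with hK
  set J : ℝ := ∫ α in a..b, |α| * g α with hJ
  set m₀ : ℝ := g 0 * ((if a < 0 ∧ 0 ≤ b then 1 / 2 else 0) + (if a ≤ 0 ∧ 0 < b then 1 / 2 else 0))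
    with hm₀
  have esum : (fun T ↦ I T - (J + m₀)) = fun T ↦ (I T - K T - J) + (K T - m₀) := by
    funext T; ring
  rw [esum, show (0 : ℝ) = 0 + 0 by ring]
  -- integrability facts at a fixed `T > 0`
  have hKi : ∀ {T : ℝ}, 0 < T → ∀ (f : ℝ → ℝ) (u v : ℝ), IntervalIntegrable f volume u v →
      IntervalIntegrable (fun α ↦ T ^ (-2 * |α|) * Real.log T * f α) volume u v := by
    intro T hT f u v hgi'
    have hc : Continuous fun α : ℝ ↦ T ^ (-2 * |α|) * Real.log T := by
      have e : (fun α : ℝ ↦ T ^ (-2 * |α|) * Real.log T) =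
          fun α ↦ Real.exp (Real.log T * (-2 * |α|)) * Real.log T := by
        funext α; rw [Real.rpow_def_of_pos hT]
      rw [e]; fun_prop
    exact hgi'.continuousOn_mul hc.continuousOn
  refine Tendsto.add ?_ ?_
  · ----------------------------------------------------------------- `I − K − J → 0`
    have hlim : Tendsto (fun T : ℝ ↦ 3 * |C₃| * B * (Real.sqrt (Real.log T))⁻¹) atTop (𝓝 0) := by
      have := ((Real.tendsto_sqrt_atTop.comp Real.tendsto_log_atTop).inv_tendsto_atTop).const_mul
        (3 * |C₃| * B)
      simpa using this
    refine squeeze_zero_norm' ?_ hlim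
    filter_upwards [hC₃, eventually_ge_atTop 3] with T hF hT3
    have hT0 : 0 < T := by linarith
    have hT1 : (1 : ℝ) < T := by linarith
    have hL0 : 0 < Real.log T := Real.log_pos hT1
    set s : ℝ := Real.sqrt (Real.log T) with hs
    have hs0 : 0 < s := Real.sqrt_pos.2 hL0
    have hFi : IntervalIntegrable (fun α ↦ montgomeryFormFactor α T * g α) volume a b :=
      hgi.continuousOn_mul (continuous_formFactor_left' T).continuousOn
    have hJi : IntervalIntegrable (fun α : ℝ ↦ |α| * g α) volume a b :=
      hgi.continuousOn_mul continuous_abs.continuousOn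
    have hdiff : I T - K T - J =
        ∫ α in a..b, (montgomeryFormFactor α T - (T ^ (-2 * |α|) * Real.log T + |α|)) * g α := by
      simp only [hI, hK, hJ]
      rw [← intervalIntegral.integral_sub hFi (hKi hT0 g a b hgi), ← intervalIntegral.integral_sub
        (hFi.sub (hKi hT0 g a b hgi)) hJi]
      refine intervalIntegral.integral_congr fun α _ ↦ ?_
      ring
    rw [hdiff]
    -- pointwise
    have hpt : ∀ α ∈ Set.Ioc a b,
        ‖(montgomeryFormFactor α T - (T ^ (-2 * |α|) * Real.log T + |α|)) * g α‖ ≤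
          |C₃| * B / s * (T ^ (-2 * |α|) * Real.log T + 1) := by
      intro α hα
      have hα1 : |α| ≤ 1 := abs_le.2 ⟨by linarith [hα.1], hα.2.trans hb⟩
      have h := hF α hα1
      have hk0 : 0 ≤ T ^ (-2 * |α|) * Real.log T + 1 := by positivity
      rw [norm_mul, Real.norm_eq_abs, Real.norm_eq_abs]
      calc |montgomeryFormFactor α T - (T ^ (-2 * |α|) * Real.log T + |α|)| * |g α|
          ≤ C₃ * (T ^ (-2 * |α|) * Real.log T + 1) / s * B :=
            mul_le_mul h (hB α ⟨hα.1.le, hα.2⟩) (abs_nonneg _)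
              ((abs_nonneg _).trans h)
        _ ≤ |C₃| * (T ^ (-2 * |α|) * Real.log T + 1) / s * B := by
            gcongr; exact le_abs_self C₃
        _ = |C₃| * B / s * (T ^ (-2 * |α|) * Real.log T + 1) := by ring
    have hbi : IntervalIntegrable (fun α ↦ |C₃| * B / s * (T ^ (-2 * |α|) * Real.log T + 1))
        volume a b := by
      have h1 : IntervalIntegrable (fun α ↦ T ^ (-2 * |α|) * Real.log T * (1 : ℝ)) volume a b :=
        hKi hT0 (fun _ ↦ 1) a b intervalIntegrable_const
      simp only [mul_one] at h1
      exact (h1.add intervalIntegrable_const).const_mul _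
    have hki : IntervalIntegrable (fun α ↦ T ^ (-2 * |α|) * Real.log T) volume a b := by
      have h1 : IntervalIntegrable (fun α ↦ T ^ (-2 * |α|) * Real.log T * (1 : ℝ)) volume a b :=
        hKi hT0 (fun _ ↦ 1) a b intervalIntegrable_const
      simpa only [mul_one] using h1
    have hIb : ∫ α in a..b, |C₃| * B / s * (T ^ (-2 * |α|) * Real.log T + 1) ≤
        3 * |C₃| * B * s⁻¹ := by
      rw [intervalIntegral.integral_const_mul, intervalIntegral.integral_add hki intervalIntegrable_const,
        intervalIntegral.integral_const, smul_eq_mul, mul_one]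
      have h1 := integral_kernel_le_one hT1 ha hab hb
      have h2 : (∫ α in a..b, T ^ (-2 * |α|) * Real.log T) + (b - a) ≤ 3 := by linarith
      calc |C₃| * B / s * ((∫ α in a..b, T ^ (-2 * |α|) * Real.log T) + (b - a))
          ≤ |C₃| * B / s * 3 := mul_le_mul_of_nonneg_left h2 (by positivity)
        _ = 3 * |C₃| * B * s⁻¹ := by ring
    exact (intervalIntegral.norm_integral_le_of_norm_le hab (Eventually.of_forall hpt) hbi).trans hIb
  · ----------------------------------------------------------------- `K − m₀ → 0`
    rcases lt_or_ge 0 a with ha0 | ha0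
    · -- `0 < a`: no mass, kernel ≤ `T^{-2a} log T`
      have hm : m₀ = 0 := by
        rw [hm₀, if_neg (by rintro ⟨h, _⟩; linarith), if_neg (by rintro ⟨h, _⟩; linarith)]; ring
      rw [hm]
      have hlim : Tendsto (fun T : ℝ ↦ B * (b - a) * (Real.log T / T ^ (2 * a))) atTop (𝓝 0) := by
        have := ((isLittleO_log_rpow_atTop (by positivity : 0 < 2 * a)).tendsto_div_nhds_zero).const_mul
          (B * (b - a))
        simpa using this
      refine squeeze_zero_norm' ?_ hlim
      filter_upwards [eventually_gt_atTop 1] with T hT1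
      have hT0 : 0 < T := by linarith
      have hL0 : 0 < Real.log T := Real.log_pos hT1
      rw [sub_zero]
      have hpt : ∀ α ∈ Set.uIoc a b, ‖T ^ (-2 * |α|) * Real.log T * g α‖ ≤
          T ^ (-2 * a) * Real.log T * B := by
        intro α hα
        rw [Set.uIoc_of_le hab] at hα
        have hαa : a ≤ |α| := hα.1.le.trans (le_abs_self α)
        rw [norm_mul, norm_mul, Real.norm_eq_abs, Real.norm_eq_abs, Real.norm_eq_abs,
          abs_of_pos (Real.rpow_pos_of_pos hT0 _), abs_of_pos hL0]
        have h1 : T ^ (-2 * |α|) ≤ T ^ (-2 * a) :=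
          Real.rpow_le_rpow_of_exponent_le hT1.le (by linarith)
        have h2 : |g α| ≤ B := hB α ⟨hα.1.le, hα.2⟩
        have h3 : 0 ≤ T ^ (-2 * |α|) := (Real.rpow_pos_of_pos hT0 _).le
        calc T ^ (-2 * |α|) * Real.log T * |g α| ≤ T ^ (-2 * a) * Real.log T * B :=
              mul_le_mul (mul_le_mul_of_nonneg_right h1 hL0.le) h2 (abs_nonneg _) (by positivity)
          _ = T ^ (-2 * a) * Real.log T * B := rfl
      refine (intervalIntegral.norm_integral_le_of_norm_le_const hpt).trans (le_of_eq ?_)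
      rw [abs_of_nonneg (by linarith : 0 ≤ b - a), show -2 * a = -(2 * a) by ring,
        Real.rpow_neg hT0.le]
      field_simp
    rcases lt_or_ge b 0 with hb0 | hb0
    · -- `b < 0`: no mass, kernel ≤ `T^{2b} log T`
      have hm : m₀ = 0 := by
        rw [hm₀, if_neg (by rintro ⟨_, h⟩; linarith), if_neg (by rintro ⟨_, h⟩; linarith)]; ring
      rw [hm]
      have hlim : Tendsto (fun T : ℝ ↦ B * (b - a) * (Real.log T / T ^ (2 * -b))) atTop (𝓝 0) := by
        have := ((isLittleO_log_rpow_atTop (by linarith : 0 < 2 * -b)).tendsto_div_nhds_zero).const_mul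
          (B * (b - a))
        simpa using this
      refine squeeze_zero_norm' ?_ hlim
      filter_upwards [eventually_gt_atTop 1] with T hT1
      have hT0 : 0 < T := by linarith
      have hL0 : 0 < Real.log T := Real.log_pos hT1
      rw [sub_zero]
      have hpt : ∀ α ∈ Set.uIoc a b, ‖T ^ (-2 * |α|) * Real.log T * g α‖ ≤
          T ^ (-2 * -b) * Real.log T * B := by
        intro α hα
        rw [Set.uIoc_of_le hab] at hα
        have hαb : -b ≤ |α| := by rw [abs_of_nonpos (hα.2.trans hb0.le)]; linarith [hα.2]
        rw [norm_mul, norm_mul, Real.norm_eq_abs, Real.norm_eq_abs, Real.norm_eq_abs,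
          abs_of_pos (Real.rpow_pos_of_pos hT0 _), abs_of_pos hL0]
        have h1 : T ^ (-2 * |α|) ≤ T ^ (-2 * -b) :=
          Real.rpow_le_rpow_of_exponent_le hT1.le (by linarith)
        have h2 : |g α| ≤ B := hB α ⟨hα.1.le, hα.2⟩
        have h3 : 0 ≤ T ^ (-2 * |α|) := (Real.rpow_pos_of_pos hT0 _).le
        exact mul_le_mul (mul_le_mul_of_nonneg_right h1 hL0.le) h2 (abs_nonneg _) (by positivity)
      refine (intervalIntegral.norm_integral_le_of_norm_le_const hpt).trans (le_of_eq ?_)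
      rw [abs_of_nonneg (by linarith : 0 ≤ b - a), show -2 * -b = -(2 * -b) by ring,
        Real.rpow_neg hT0.le]
      field_simp
    -- `a ≤ 0 ≤ b`: split at `0`
    have hm : m₀ = g 0 * (if a < 0 then 1 / 2 else 0) + g 0 * (if 0 < b then 1 / 2 else 0) := by
      rw [hm₀]
      have e1 : (if a < 0 ∧ 0 ≤ b then (1 : ℝ) / 2 else 0) = if a < 0 then 1 / 2 else 0 := by
        by_cases h1 : a < 0 <;> simp [h1, hb0]
      have e2 : (if a ≤ 0 ∧ 0 < b then (1 : ℝ) / 2 else 0) = if 0 < b then 1 / 2 else 0 := by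
        by_cases h2 : 0 < b <;> simp [h2, ha0]
      rw [e1, e2]; ring
    -- right piece
    have hR : Tendsto (fun T : ℝ ↦ ∫ α in (0 : ℝ)..b, T ^ (-2 * |α|) * Real.log T * g α) atTop
        (𝓝 (g 0 * (if 0 < b then 1 / 2 else 0))) := by
      rcases eq_or_lt_of_le hb0 with hb00 | hbpos
      · rw [← hb00, if_neg (lt_irrefl _), mul_zero]
        simp only [intervalIntegral.integral_same]
        exact tendsto_const_nhds
      rw [if_pos hbpos, ← div_eq_mul_one_div]
      have hgi' : IntervalIntegrable g volume 0 b :=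
        hgi.mono_set (by rw [uIcc_of_le hab, uIcc_of_le hb0]; exact Icc_subset_Icc ha0 le_rfl)
      have h := tendsto_integral_rpow_mul_log_mul hbpos hgi' (B := B)
        (fun α hα ↦ hB α ⟨ha0.trans hα.1, hα.2⟩) hδ (Cg := Cg)
        (fun α hα0 hαδ ↦ by
          have := hLip α (by rwa [abs_of_nonneg hα0]); rwa [abs_of_nonneg hα0] at this)
      refine h.congr' (Eventually.of_forall fun T ↦ ?_)
      refine intervalIntegral.integral_congr fun α hα ↦ ?_
      rw [uIcc_of_le hbpos.le] at hα
      simp only [abs_of_nonneg hα.1]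
    -- left piece, by `α ↦ −α`
    have hL : Tendsto (fun T : ℝ ↦ ∫ α in a..(0 : ℝ), T ^ (-2 * |α|) * Real.log T * g α) atTop
        (𝓝 (g 0 * (if a < 0 then 1 / 2 else 0))) := by
      rcases eq_or_lt_of_le ha0 with ha00 | haneg
      · rw [ha00, if_neg (lt_irrefl _), mul_zero]
        simp only [intervalIntegral.integral_same]
        exact tendsto_const_nhds
      rw [if_pos haneg, ← div_eq_mul_one_div]
      have hna : 0 < -a := by linarith
      have hgi0 : IntervalIntegrable g volume a 0 :=
        hgi.mono_set (by rw [uIcc_of_le hab, uIcc_of_le ha0]; exact Icc_subset_Icc le_rfl hb0)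
      have hgi' : IntervalIntegrable (fun x ↦ g (-x)) volume 0 (-a) := by
        have h := (IntervalIntegrable.iff_comp_neg).1 hgi0
        rw [neg_zero] at h
        exact h.symm
      have h := tendsto_integral_rpow_mul_log_mul hna hgi' (B := B)
        (fun α hα ↦ hB (-α) ⟨by linarith [hα.2], by linarith [hα.1]⟩) hδ (Cg := Cg)
        (fun α hα0 hαδ ↦ by
          rw [neg_zero]
          have := hLip (-α) (by rwa [abs_neg, abs_of_nonneg hα0])
          rwa [abs_neg, abs_of_nonneg hα0] at this)
      rw [neg_zero] at h
      refine h.congr' (Eventually.of_forall fun T ↦ ?_)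
      have hc := intervalIntegral.integral_comp_neg (a := 0) (b := -a)
        (fun α : ℝ ↦ T ^ (-2 * |α|) * Real.log T * g α)
      rw [neg_neg, neg_zero] at hc
      show _ = ∫ α in a..(0 : ℝ), T ^ (-2 * |α|) * Real.log T * g α
      rw [← hc]
      refine intervalIntegral.integral_congr fun α hα ↦ ?_
      rw [uIcc_of_le hna.le] at hα
      simp only [abs_neg, abs_of_nonneg hα.1]
    -- assemble
    have hsum : ∀ᶠ T : ℝ in atTop, (∫ α in a..(0 : ℝ), T ^ (-2 * |α|) * Real.log T * g α) +
        (∫ α in (0 : ℝ)..b, T ^ (-2 * |α|) * Real.log T * g α) - m₀ = K T - m₀ := by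
      filter_upwards [eventually_gt_atTop 0] with T hT0
      rw [hK]
      simp only
      rw [intervalIntegral.integral_add_adjacent_intervals (hKi hT0 g a 0 (hgi.mono_set (by
          rw [uIcc_of_le hab, uIcc_of_le ha0]; exact Icc_subset_Icc le_rfl hb0)))
        (hKi hT0 g 0 b (hgi.mono_set (by
          rw [uIcc_of_le hab, uIcc_of_le hb0]; exact Icc_subset_Icc ha0 le_rfl)))]
    have h := (hL.add hR).sub_const m₀
    rw [hm, show g 0 * (if a < 0 then 1 / 2 else (0 : ℝ)) + g 0 * (if 0 < b then 1 / 2 else 0) -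
      (g 0 * (if a < 0 then 1 / 2 else 0) + g 0 * (if 0 < b then 1 / 2 else 0)) = (0 : ℝ) by ring] at h
    rw [← hm] at h
    exact h.congr' hsum


/-- "Riemann integrable on `[a, b]`" as rendered in the typed `bgstb2025_theorem3` (bounded on `[a, b]` and
continuous within `[a, b]` at almost every point — Lebesgue's criterion) implies interval integrability,
so that `Montgomery.tendsto_integral_formFactor_mul_of_subset_Icc` applies to such `g`. [folklore] -/
private theorem intervalIntegrable_of_bdd_of_ae_continuousWithinAt {a b : ℝ} (hab : a ≤ b)
    {g : ℝ → ℝ} {B : ℝ} (hB : ∀ x ∈ Set.Icc a b, |g x| ≤ B)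
    (hcont : ∀ᵐ x ∂(volume.restrict (Set.Icc a b)), ContinuousWithinAt g (Set.Icc a b) x) :
    IntervalIntegrable g volume a b := by
  set μ : Measure ℝ := volume.restrict (Set.Icc a b) with hμ
  -- a measurable null set off which `g` is continuous within `[a, b]`
  have hN : μ {x | ¬ContinuousWithinAt g (Set.Icc a b) x} = 0 := ae_iff.1 hcont
  obtain ⟨N, hNsub, hNmeas, hN0⟩ := exists_measurable_superset_of_null hN
  set S : Set ℝ := Set.Icc a b \ N with hS
  have hSmeas : MeasurableSet S := measurableSet_Icc.diff hNmeas
  have hgS : ContinuousOn g S := by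
    intro x hx
    have hx' : ContinuousWithinAt g (Set.Icc a b) x := by
      by_contra h
      exact hx.2 (hNsub h)
    exact hx'.mono Set.sdiff_subset
  have hSae : S =ᵐ[volume] Set.Icc a b := by
    refine (ae_eq_set).2 ⟨?_, ?_⟩
    · rw [Set.sdiff_eq_empty.2 Set.sdiff_subset, measure_empty]
    · have e : Set.Icc a b \ S = N ∩ Set.Icc a b := by
        ext x; simp only [hS, Set.mem_sdiff, Set.mem_inter_iff, not_and, not_not]; tauto
      rw [e, ← Measure.restrict_apply hNmeas]
      exact hN0
  have hmeas : AEStronglyMeasurable g μ := by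
    rw [hμ, ← Measure.restrict_congr_set hSae]
    exact hgS.aestronglyMeasurable hSmeas
  have hint : Integrable g μ := by
    refine Integrable.mono' (integrable_const B) hmeas ?_
    rw [hμ]
    exact (ae_restrict_iff' measurableSet_Icc).2 (Eventually.of_forall fun x hx ↦ by
      rw [Real.norm_eq_abs]; exact hB x hx)
  rw [intervalIntegrable_iff_integrableOn_Ioc_of_le hab]
  exact IntegrableOn.mono_set hint Set.Ioc_subset_Icc_self

/-- `Montgomery.tendsto_integral_formFactor_mul_of_subset_Icc` with the hypotheses on `g` in the form of the
typed `bgstb2025_theorem3` ("Riemann integrable": bounded and a.e. continuous within `[a, b]`; Lipschitz at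
`0`, spelled out). [cite: BaluyotGoldstonSuriajayaTurnageButterbaugh2025, §7 (proof of Theorem 3)] -/
theorem tendsto_integral_formFactor_mul_of_subset_Icc' (hRH : RiemannHypothesis) {a b : ℝ}
    {g : ℝ → ℝ} (hab : a ≤ b) (ha : -1 ≤ a) (hb : b ≤ 1)
    (hbdd : ∃ B : ℝ, ∀ x ∈ Set.Icc a b, |g x| ≤ B)
    (hcont : ∀ᵐ x ∂(volume.restrict (Set.Icc a b)), ContinuousWithinAt g (Set.Icc a b) x)
    (hLip : ∃ C δ : ℝ, 0 < δ ∧ ∀ x : ℝ, |x - 0| < δ → |g x - g 0| ≤ C * |x - 0|) :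
    Tendsto (fun T : ℝ ↦ (∫ α in a..b, montgomeryFormFactor α T * g α) -
        ((∫ α in a..b, |α| * g α) +
          g 0 * ((if a < 0 ∧ 0 ≤ b then 1 / 2 else 0) + (if a ≤ 0 ∧ 0 < b then 1 / 2 else 0))))
      atTop (𝓝 0) := by
  obtain ⟨B, hB⟩ := hbdd
  exact tendsto_integral_formFactor_mul_of_subset_Icc hRH hab ha hb
    (intervalIntegrable_of_bdd_of_ae_continuousWithinAt hab hB hcont) hB hLip

end Montgomery

/-! ## In the vocabulary of the typed claim `bgstb2025_theorem3` -/

/-- On `[a, b] ⊆ [−1, 1]` the limiting form factor's integral has only the `|α|` part and the mass at `0`: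
`AH.calFIntegral P₀ a b g = ∫_a^b |α| g(α) dα + g(0)(½[a<0≤b] + ½[a≤0<b])` for every `P₀`
(BGSTB 2025, (calF): `s(α) = |α|` for `|α| ≤ 1`; the masses at `±1` are one-sided AWAY from `[−1, 1]`,
and no even `m ≠ 0` or odd `|m| ≥ 3` lies in `(a, b)`). [cite: BaluyotGoldstonSuriajayaTurnageButterbaugh2025, §2 (calF)] -/
theorem AH.calFIntegral_eq_of_subset_Icc (P₀ : ℝ) {a b : ℝ} (ha : -1 ≤ a) (hab : a ≤ b) (hb : b ≤ 1)
    (g : ℝ → ℝ) :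
    AH.calFIntegral P₀ a b g = (∫ α in a..b, |α| * g α) +
      g 0 * ((if a < 0 ∧ 0 ≤ b then 1 / 2 else 0) + (if a ≤ 0 ∧ 0 < b then 1 / 2 else 0)) := by
  unfold AH.calFIntegral
  have h1 : (if a ≤ 1 ∧ 1 < b then (1 : ℝ) else 0) = 0 := if_neg (by rintro ⟨_, h⟩; linarith)
  have h2 : (if a < -1 ∧ -1 ≤ b then (1 : ℝ) else 0) = 0 := if_neg (by rintro ⟨h, _⟩; linarith)
  have hIoo : ∀ m ∈ Finset.Ioo ⌊a⌋ ⌈b⌉, m = 0 := by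
    intro m hm
    rw [Finset.mem_Ioo] at hm
    have h3 : (-1 : ℤ) ≤ ⌊a⌋ := by rw [Int.le_floor]; push_cast; exact ha
    have h4 : ⌈b⌉ ≤ (1 : ℤ) := by rw [Int.ceil_le]; push_cast; exact hb
    omega
  have hs1 : ∑ m ∈ (Finset.Ioo ⌊a⌋ ⌈b⌉).filter (fun m ↦ Even m ∧ m ≠ 0), g m = 0 := by
    refine Finset.sum_eq_zero fun m hm ↦ ?_
    rw [Finset.mem_filter] at hm
    exact absurd (hIoo m hm.1) hm.2.2
  have hs2 : ∑ m ∈ (Finset.Ioo ⌊a⌋ ⌈b⌉).filter (fun m ↦ Odd m ∧ 3 ≤ |m|), g m = 0 := by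
    refine Finset.sum_eq_zero fun m hm ↦ ?_
    rw [Finset.mem_filter] at hm
    have h0 := hIoo m hm.1
    have h3 := hm.2.2
    rw [h0, abs_zero] at h3
    omega
  have hint : ∫ α in a..b, triangleWave α * g α = ∫ α in a..b, |α| * g α := by
    refine intervalIntegral.integral_congr fun α hα ↦ ?_
    rw [uIcc_of_le hab] at hα
    have hα1 : |α| ≤ 1 := abs_le.2 ⟨by linarith [hα.1], by linarith [hα.2]⟩
    show triangleWave α * g α = |α| * g α
    rw [triangleWave_of_abs_le_one hα1]
  rw [hint, h1, h2, hs1, hs2]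
  ring

/-- **BGSTB 2025, Theorem 3 on `[a, b] ⊆ [−1, 1]` — PROVED from RH alone, in the binder shape of the typed
claim `bgstb2025_theorem3`** (AH-Pairs and the Lipschitz conditions at the integers `≠ 0` are not needed on
this range; `P₀` may be ANY function of `T`, in particular `AH.binDensity 0 T M δ`): for `a ≤ b`,
`−1 ≤ a`, `b ≤ 1`, `g` "Riemann integrable" on `[a, b]` (bounded, a.e. continuous within) and Lipschitz at `0`,
`∫_a^b F(α,T) g(α) dα − AH.calFIntegral (P₀ T) a b g → 0`.
[cite: BaluyotGoldstonSuriajayaTurnageButterbaugh2025, §7 (proof of Theorem 3)] -/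
theorem bgstb2025_theorem3_of_subset_Icc (hRH : RiemannHypothesis) {a b : ℝ} {g : ℝ → ℝ}
    (hab : a ≤ b) (ha : -1 ≤ a) (hb : b ≤ 1) (hbdd : ∃ B : ℝ, ∀ x ∈ Set.Icc a b, |g x| ≤ B)
    (hcont : ∀ᵐ x ∂(volume.restrict (Set.Icc a b)), ContinuousWithinAt g (Set.Icc a b) x)
    (hLip : IsLipschitzAt g 0) (P₀ : ℝ → ℝ) :
    Tendsto (fun T : ℝ ↦ (∫ α in a..b, montgomeryFormFactor α T * g α) -
      AH.calFIntegral (P₀ T) a b g) atTop (𝓝 0) := by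
  refine Tendsto.congr (fun T ↦ ?_)
    (Montgomery.tendsto_integral_formFactor_mul_of_subset_Icc' hRH hab ha hb hbdd hcont hLip)
  rw [AH.calFIntegral_eq_of_subset_Icc (P₀ T) ha hab hb g]

/-- The `[a, b] ⊆ [−1, 1]` conjunct of `bgstb2025_theorem3`, literally (with its `δ`, `M` quantifiers, which
play no role on this range), from RH alone. [cite: BaluyotGoldstonSuriajayaTurnageButterbaugh2025, §7 (proof of Theorem 3)] -/
theorem bgstb2025_theorem3_of_subset_Icc' (hRH : RiemannHypothesis) (a b : ℝ) (g : ℝ → ℝ)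
    (hab : a ≤ b) (ha : -1 ≤ a) (hb : b ≤ 1) (hbdd : ∃ B : ℝ, ∀ x ∈ Set.Icc a b, |g x| ≤ B)
    (hcont : ∀ᵐ x ∂(volume.restrict (Set.Icc a b)), ContinuousWithinAt g (Set.Icc a b) x)
    (hLip : IsLipschitzAt g 0) :
    ∀ δ : ℝ, 0 < δ → δ ≤ 1 / 2 → ∀ᶠ M : ℝ in atTop,
      Tendsto (fun T : ℝ ↦ (∫ α in a..b, montgomeryFormFactor α T * g α) -
        AH.calFIntegral (AH.binDensity 0 T M δ) a b g) atTop (𝓝 0) :=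
  fun δ _ _ ↦ Eventually.of_forall fun M ↦
    bgstb2025_theorem3_of_subset_Icc hRH hab ha hb hbdd hcont hLip fun T ↦ AH.binDensity 0 T M δ

end Literature.NumberTheory.LFunctions

end
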